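import Literature.NumberTheory.Automorphic.Liu2021.RecordCurveEichlerShimura
import Literature.AlgebraicGeometry.Motives.AbelianSchemeModelTateSpecialisationFamily
import HarnessLib

/-!
# The `∀ R` form of the Eichler–Shimura letter for `Alb(M⋆_K)` implies its MODEL form (proof-lane sequel of
# `Liu2021/RecordCurveEichlerShimura.lean`)

Topic `NumberTheory/Automorphic/Liu2021`; namespace `Literature.NumberTheory.Automorphic.Liu2021`.  ONE theorem, no definition,
no named fact, no `sorry`: `recordCurve_albanese_eichlerShimuraModel_of : recordCurve_albanese_eichlerShimura →
recordCurve_albanese_eichlerShimuraModel` — the cofinite good-reduction theorem ★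
`AbelianVariety.exists_finite_forall_exists_goodReductionAt_homReduction_tateSpecialisation` (at the ONE abelian variety `A_K`,
`J := Unit`) supplies, off a finite set of places, a good-reduction datum `R` with `ℓ`-adic specialisations for every `ℓ` with
`w ∤ ℓ`; the `∀ R` identity is then read at that `R`.  Proof transcribed from A-p05 (g15)'s kernel-checked
`recordCurveEichlerShimuraModel_of_forall` (cell hodgecm-mathlib, F0 P5, rf v2 35eddcef).  HC_CM is proved only modulo the printed
citations until rung 0 closes.

## References
* [Shimura1998] G. Shimura, *Abelian varieties with complex multiplication and modular functions*, §11.1 Prop. 12 and 14, §19.4.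
* [Liu2021] Y. Liu, Camb. J. Math. 9 (2021) = arXiv:2102.11518, App. D Prop. D.8, Cor. D.9.
-/

noncomputable section

namespace Literature.NumberTheory.Automorphic.Liu2021

open CategoryTheory _root_.NumberField _root_.IsDedekindDomain
open scoped _root_.Matrix
open Literature.AlgebraicGeometry.Motives
open Literature.AlgebraicGeometry.Motives.AbelianVariety (exists_finite_forall_exists_goodReductionAt_homReduction_tateSpecialisation)
open Literature.AlgebraicGeometry.ShimuraVarieties.UnitaryCanonicalModel
open Literature.NumberTheory.Automorphic Literature.NumberTheory.Automorphic.UnitaryGroup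
open Literature.NumberTheory.Automorphic.Liu2021.AppendixC
open Literature.NumberTheory.GaloisRepresentations

/-- **The `∀ R` letter implies the MODEL letter**, off the finite exceptional set of the cofinite good-reduction theorem (★
`AbelianVariety.exists_finite_forall_exists_goodReductionAt_homReduction_tateSpecialisation` at the ONE abelian variety `A_K`,
`J := Unit`, supplies an `R` with `ℓ`-adic specialisations for every `ℓ` with `w ∤ ℓ`).  Proof transcribed from A-p05 (g15) rf v2
`recordCurveEichlerShimuraModel_of_forall`. [cite: Shimura1998, §11.1 Prop. 14 (i) and §19.4] -/
theorem recordCurve_albanese_eichlerShimuraModel_of (hL3 : recordCurve_albanese_eichlerShimura) :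
    recordCurve_albanese_eichlerShimuraModel := by
  intro F _ _ _ ι₁ Jstar K₀ S hU7ₛ h4 isoₛ hJ hJu K
  refine (exists_finite_forall_exists_goodReductionAt_homReduction_tateSpecialisation (J := Unit)
    (fun _ => (sec42DataGSM S h4 isoₛ).A K)).elim fun S₁ hS₁ => ?_
  refine (hL3 F ι₁ Jstar K₀ S hU7ₛ h4 isoₛ hJ hJu K).elim fun S₃ hS₃ => ⟨S₁ ∪ S₃, hS₁.1.union hS₃.1, ?_⟩
  intro w hw₀ hw hunit hhyp
  refine (hS₁.2 w (fun h => hw₀ (Or.inl h))).elim fun R hR => hR.elim fun _ hT =>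
    ⟨R (), fun ℓ _ hwℓ => (hT ℓ hwℓ).elim fun TS _ => ⟨TS ()⟩, fun ℓ _ θ₁ θ₂ m₁ m₂ hm₁ hm₂ hθ₁ hθ₂ => ?_⟩
  exact hS₃.2 w (fun h => hw₀ (Or.inr h)) hw hunit hhyp ℓ θ₁ θ₂ m₁ m₂ hm₁ hm₂ hθ₁ hθ₂ (R ())

end Literature.NumberTheory.Automorphic.Liu2021

end
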